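import Summits.RiemannHypothesis.RiemannHypothesis.Theses.SignCone
import Summits.RiemannHypothesis.RiemannHypothesis.Theorems.SignConeOscillatory.Negative.WithoutPD
import Summits.RiemannHypothesis.RiemannHypothesis.Theorems.SignConeOscillatory.Negative.WithoutNodeNonneg
import Summits.RiemannHypothesis.RiemannHypothesis.Theorems.SignConeOscillatory.Negative.SlackUnbounded
import Summits.RiemannHypothesis.RiemannHypothesis.Theorems.SignConeSignConeOscillatoryEnvelope
import Summits.RiemannHypothesis.RiemannHypothesis.Theorems.SignConeSignConeOscillatoryIffInequality

/-!
# Disproof of `SignConeOscillatory` (crux stmt-RiemannHypothesis-16302, route `SignCone`) — findings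

Crux workfile of the standing disprover (seat `refuter-cdisprove-stmt-RiemannHypothesis-16302-0`, cycle 1,
2026-08-16). Prose only in docstrings; everything below elaborates against the tree (no `sorry` except in §A′,
a documented near-miss).

## Verdict of cycle 1: NO KILL POSSIBLE SHORT OF `¬RH`; two load-bearing lemmas LANDED

0. **Status (landed by route seats before this seat opened; used in §0):** `RiemannHypothesis →
   SignConeOscillatory` (`SignCone.signConeOscillatory_of_riemannHypothesis`, p128354: explicit formula
   `explicit_formula_holds` + easy half of Weil's criterion + `Re P_Λ ≥ 0` on the sign cone), and
   `SignConeOscillatory ↔ SignConeInequality` (= the route TARGET, p129083: the oscillation hypothesis is idle under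
   the `∀`-cutoff quantifier). So the crux is RH-implied and target-equivalent; an unconditional `¬` would be a
   disproof of RH. The elaboration audit is clean: the item body is `Iff.rfl`-equal to the Literature form
   `-(F 0).re ≤ (weilPolarTerm F + weilArchTerm F).re` (checked in `W.lean`, rc 0), `Complex.digamma` is Mathlib's,
   no junk operators (`tsum`, `/`, `sSup`) bite: the prime-free functional is a finite Bochner expression on Weil tests.
1. **§A positive-definiteness is load-bearing** (`signConeOscillatory_false_without_PD`, LANDED p130023 as
   `Theorems/SignConeOscillatory/Negative/WithoutPD.lean`): replacing the cone structure `F = Σᵢ gᵢ ⋆ g̃ᵢ` by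
   "`F` smooth, compactly supported in `[-2a, 2a]`, hermitian" (nodes, oscillation, conclusion verbatim) is FALSE.
   Witness `a = 1`, `F = -(φ(· - 9/10) + φ(· + 9/10))`, `φ = moll 11`: `Re W_ar(F) ≤ -4 + e·60/49 < 0 = -Re F(0)`.
2. **§B node non-negativity is load-bearing** (`signConeOscillatory_false_without_nodeNonneg`, LANDED p130128 as
   `Theorems/SignConeOscillatory/Negative/WithoutNodeNonneg.lean`): deleting `∀ n ≥ 2, 0 ≤ Re F(log n)` (all else
   verbatim) is FALSE. Witness `k = 1`, antisymmetric two-bump `w_c = φ(· + c/2) - φ(· - c/2)` (`φ = moll 0`),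
   `a = c/2 + 1`, `c → ∞`: `Re weilPolarTerm(w⋆w̃) = -8 sinh²(c/4) φ̂(0)φ̂(1)` while the archimedean integral is
   bounded independently of `c` and `Re G(0)(1 - log π) ≤ 0`. (Numerically the hn-free minimum crosses `-1`
   already at `a ≈ 1.05`: rattack j020164, ideator LP j020376.) STRENGTHENING (LANDED p130579,
   `Negative/SlackUnbounded.lean`): for EVERY `C : ℝ` the hn-free statement with slack `-C·Re F(0)` is false
   (`signConeOscillatory_false_without_nodeNonneg_anySlack`; `exists_twoBump_re_weilArchPolar_lt`) — no constant
   slack substitutes for the node signs, so "weaken the slack" is not a repair.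
3. **§C NOT load-bearing:** the oscillation hypothesis (dropping it gives the target, which is EQUIVALENT to the
   crux: `withoutOsc_iff`); the composite nodes MODULO RH (`signConeOscillatory_primePowerNodes_of_riemannHypothesis`:
   under RH the inequality needs `Re F(log n) ≥ 0` only at prime powers `n = p^k` — so no
   `_false_without_compositeNodes` can exist short of `¬RH`; unconditionally the 2001 rigidity `K ⊆ {Λ}` says the
   same); the support hypothesis / the cutoff `a` by itself (`withoutSupport_of_crux`: the content is `a = ∞`);
   the guard `0 < a` and the case `k = 0` (vacuous: `F = 0` is not oscillatory); the cutoff `a ≤ (log 2)/2`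
   (class empty, `SignCone.oscillatoryClass_nonempty_iff`, p129355).
4. **§A′ near-miss (documented `sorry`)**: even keeping ORIGIN DOMINATION `‖F t‖ ≤ Re F(0)` (with hermitian
   symmetry, node signs and oscillation) the inequality fails — far NEGATIVE plateau-bump pairs of height `F(0)` in
   the node gaps above `n = 2, 4, 8, 16` gain polar energy `≈ 4cosh(L/2)·mass` each against a bounded archimedean
   cost, while a central plateau bump `h₀` of radius `1/4` has `Re W_ar(h₀) + h₀(0) ≈ 0.97 h₀(0)`; estimated
   margin `≈ 1.0·F(0)` (crude bounds). This separates the oscillatory crux from its far-field sibling, whose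
   bookkeeping proof uses exactly hermitian + `|F| ≤ F(0)` + far-field sign
   (`SignConeFarField/Negative/OriginDominates.lean`). Not yet kernel-checked (≈ 700 lines of interval bookkeeping:
   `log 5…log 17` via `j·log 2 + 1/(n+1)`, `cosh`/`sinh` cell bounds); left for cycle 2 if granted.
5. **Why it resists (for ideators/provers):** every attack on TRUTH reduces to `¬RH` (items 0); the content sits
   entirely in the node signs AT PRIME POWERS interacting with positive-definiteness (items 1–3): a proof must turn
   `F̂ ≥ 0` + `F(log p^k) ≥ 0` into control of the indefinite rank-2 polar form `2Re(ĝ(0) conj ĝ(1))`, i.e. it must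
   re-derive `P_Λ`-type information from the node train — Cor noE of the 2001 programme in Lean clothing.
6. **Targets (§T):** line `Sketch` (lead, 22:41Z): all 7 stubs re-derived on paper — 6 are TRUE exact
   identities/elementary, the terminal `stub_fakeZeroMeasure` is RH-implied (RH-equivalent given the siblings);
   joint sufficiency is sorry-free in the skeleton. No `stub_*_false` exists; details and the sign/constant checks
   in §T. Literature negatives: none known (search degraded this session: searchd reset, S2 429, arXiv 0 rows).
-/

noncomputable section

-- `Summit.RiemannHypothesis.RiemannHypothesis.…` repeats a namespace component by design (D-0017 layout).
set_option linter.dupNamespace false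

open scoped BigOperators ComplexConjugate ArithmeticFunction.vonMangoldt
open Complex MeasureTheory Set Filter

namespace Summit.RiemannHypothesis.RiemannHypothesis.Cruxes.SignConeOscillatory.Disproof

open Literature.NumberTheory.LFunctions
open Summit.RiemannHypothesis.RiemannHypothesis.Theses.SignCone
open Summit.RiemannHypothesis.RiemannHypothesis.Theorems.SignCone
open Summit.RiemannHypothesis.RiemannHypothesis.Theorems.RuelleBandCofiniteCriticalLine

/-! ## §0 Status: the crux is RH-implied and target-equivalent (re-exports of landed theorems) -/

/-- `SignConeOscillatory ↔ SignConeInequality` (landed, p129083): the crux IS the route target. [folklore] -/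
theorem crux_iff_target : SignConeOscillatory ↔ SignConeInequality :=
  signConeOscillatory_iff_signConeInequality

/-- Kill propagation: a refutation of the crux is a disproof of RH. [folklore] -/
theorem not_riemannHypothesis_of_not_crux (h : ¬ SignConeOscillatory) : ¬ RiemannHypothesis :=
  fun hRH => h (signConeOscillatory_of_riemannHypothesis hRH)

/-! ## §A Load-bearing: positive-definiteness (the cone structure of `F`) -/

/-- The crux with "`F = Σᵢ gᵢ ⋆ g̃ᵢ`, `supp gᵢ ⊆ [-a, a]`" replaced by "`F` smooth, compactly supported in
`[-2a, 2a]`, hermitian"; node hypothesis, oscillation hypothesis and conclusion verbatim. [folklore] -/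
def SignConeOscillatoryWithoutPD : Prop :=
  ∀ a : ℝ, 0 < a → ∀ F : ℝ → ℂ,
    (ContDiff ℝ ((⊤ : ℕ∞) : WithTop ℕ∞) F ∧ HasCompactSupport F) ∧ tsupport F ⊆ Set.Icc (-(2 * a)) (2 * a) →
    (∀ u : ℝ, F (-u) = (starRingEnd ℂ) (F u)) →
    (∀ n : ℕ, 2 ≤ n → 0 ≤ (F (Real.log n)).re) → (∃ t : ℝ, Real.log 2 ≤ |t| ∧ (F t).re < 0) →
    let M : ℂ → ℂ := fun s => ∫ u : ℝ, F u * Complex.exp ((s - 1 / 2) * u);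
    -(F 0).re ≤ (M 0 + M 1 + ((1 / (2 * Real.pi) : ℂ) * (∫ t : ℝ, M (1 / 2 + t * Complex.I) *
      ((Complex.digamma (1 / 4 + t / 2 * Complex.I)).re : ℂ)) - F 0 * (Real.log Real.pi : ℂ))).re

/-- **Any proof must use positive-definiteness** (LANDED p130023,
`Theorems/SignConeOscillatory/Negative/WithoutPD.lean`): witness `a = 1`, `F = -(φ(· - 9/10) + φ(· + 9/10))`,
`φ = WeilContinuous.moll 11`; `Re W_ar(F) ≤ -4 + e·60/49 < 0 = -Re F(0)`. [folklore] -/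
theorem signConeOscillatory_false_without_PD : ¬ SignConeOscillatoryWithoutPD :=
  _root_.Summit.RiemannHypothesis.RiemannHypothesis.Theorems.SignConeOscillatory.Negative.signConeOscillatory_false_without_PD

/-! ## §B Load-bearing: node non-negativity -/

/-- The crux with the node hypothesis `∀ n ≥ 2, 0 ≤ Re F(log n)` deleted; everything else verbatim. [folklore] -/
def SignConeOscillatoryWithoutNodeNonneg : Prop :=
  ∀ a : ℝ, 0 < a → ∀ (k : ℕ) (g : Fin k → ℝ → ℂ), (∀ i, (ContDiff ℝ ((⊤ : ℕ∞) : WithTop ℕ∞) (g i) ∧ HasCompactSupport (g i)) ∧ tsupport (g i) ⊆ Set.Icc (-a) a) → let F : ℝ → ℂ := fun t => ∑ i, MeasureTheory.convolution (g i) (fun u => (starRingEnd ℂ) ((g i) (-u))) (ContinuousLinearMap.mul ℂ ℂ) MeasureTheory.MeasureSpace.volume t; (∃ t : ℝ, Real.log 2 ≤ |t| ∧ (F t).re < 0) → let M : ℂ → ℂ := fun s => ∫ u : ℝ, F u * Complex.exp ((s - 1 / 2) * u); -(F 0).re ≤ (M 0 + M 1 + ((1 / (2 * Real.pi) : ℂ)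 * (∫ t : ℝ, M (1 / 2 + t * Complex.I) * ((Complex.digamma (1 / 4 + t / 2 * Complex.I)).re : ℂ)) - F 0 * (Real.log Real.pi : ℂ))).re

/-- **Any proof must use the node signs** (LANDED p130128,
`Theorems/SignConeOscillatory/Negative/WithoutNodeNonneg.lean`): witness `k = 1`, `g = w_c = φ(·+c/2) - φ(·-c/2)`
(`φ = WeilContinuous.moll 0`), `a = c/2 + 1`, `c = 4(1+K)`; the polar term `-8 sinh²(c/4) φ̂(0) φ̂(1)` of the
antisymmetric far pair beats the `c`-free archimedean bound. [folklore] -/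
theorem signConeOscillatory_false_without_nodeNonneg : ¬ SignConeOscillatoryWithoutNodeNonneg :=
  _root_.Summit.RiemannHypothesis.RiemannHypothesis.Theorems.SignConeOscillatory.Negative.signConeOscillatory_false_without_nodeNonneg

/-- **…and no constant slack rescues it** (LANDED p130579, `Theorems/SignConeOscillatory/Negative/SlackUnbounded.lean`):
for every `C : ℝ`, the hn-free statement with conclusion `-C·Re F(0) ≤ Re W_ar(F)` is false. [folklore] -/
theorem signConeOscillatory_false_without_nodeNonneg_anySlack (C : ℝ) :
    ¬ (∀ a : ℝ, 0 < a → ∀ (k : ℕ) (g : Fin k → ℝ → ℂ), (∀ i, (ContDiff ℝ ((⊤ : ℕ∞) : WithTop ℕ∞) (g i) ∧ HasCompactSupport (g i)) ∧ tsupport (g i) ⊆ Set.Icc (-a) a) → let F : ℝ → ℂ := fun t => ∑ i, MeasureTheory.convolution (g i) (fun u => (starRingEnd ℂ) ((g i) (-u))) (ContinuousLinearMap.mul ℂ ℂ) MeasureTheory.MeasureSpace.volume t; (∃ t : ℝ, Real.log 2 ≤ |t| ∧ (F t).re < 0) → let M : ℂ → ℂ := fun s => ∫ u : ℝ, F u *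 Complex.exp ((s - 1 / 2) * u); -(C * (F 0).re) ≤ (M 0 + M 1 + ((1 / (2 * Real.pi) : ℂ) * (∫ t : ℝ, M (1 / 2 + t * Complex.I) * ((Complex.digamma (1 / 4 + t / 2 * Complex.I)).re : ℂ)) - F 0 * (Real.log Real.pi : ℂ))).re) :=
  _root_.Summit.RiemannHypothesis.RiemannHypothesis.Theorems.SignConeOscillatory.Negative.signConeOscillatory_false_without_nodeNonneg_anySlack C

/-- The deleted hypothesis really is the only difference: crux = (node hypothesis → mutated body). [folklore] -/
theorem withoutNodeNonneg_imp_crux (h : SignConeOscillatoryWithoutNodeNonneg) : SignConeOscillatory :=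
  fun a ha k g hg _hn hosc => h a ha k g hg hosc

/-! ## §C Not load-bearing -/

/-- **The oscillation hypothesis is idle**: deleting it gives the route target `SignConeInequality`, which is
EQUIVALENT to the crux (landed p129083). So no `_false_without_osc` exists short of `¬RH`. [folklore] -/
theorem withoutOsc_iff : SignConeInequality ↔ SignConeOscillatory :=
  signConeOscillatory_iff_signConeInequality.symm

/-- The prime term needs the node signs only where `Λ(n) ≠ 0`: on a hermitian compactly supported kernel with
`Re F(log n) ≥ 0` at PRIME POWERS, `Re P_Λ(F) ≥ 0`. [folklore] -/
theorem re_weilPrimeTerm_nonneg_of_primePowerNodes {F : ℝ → ℂ} (hFc : HasCompactSupport F)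
    (hsym : ∀ t : ℝ, conj (F (-t)) = F t)
    (hn : ∀ n : ℕ, 2 ≤ n → IsPrimePow n → 0 ≤ (F (Real.log n)).re) :
    0 ≤ (weilPrimeTerm F).re := by
  unfold weilPrimeTerm
  rw [Complex.re_tsum (summable_weilPrimeTerm hFc)]
  refine tsum_nonneg fun n => ?_
  have hcoef : ((Λ n : ℝ) : ℂ) / (Real.sqrt n : ℂ) = ((Λ n / Real.sqrt n : ℝ) : ℂ) := by
    push_cast
    rfl
  by_cases hpp : IsPrimePow n
  · have hn2 : 2 ≤ n := hpp.two_le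
    have hre' : (F (-Real.log n)).re = (F (Real.log n)).re := by
      have h := congrArg Complex.re (hsym (Real.log n))
      simpa only [Complex.conj_re] using h
    have hre : (F (Real.log n) + F (-Real.log n)).re = 2 * (F (Real.log n)).re := by
      rw [Complex.add_re, hre']
      ring
    rw [hcoef, Complex.re_ofReal_mul, hre]
    exact mul_nonneg (div_nonneg ArithmeticFunction.vonMangoldt_nonneg (Real.sqrt_nonneg _))
      (by nlinarith [hn n hn2 hpp])
  · have hΛ : Λ n = 0 := ArithmeticFunction.vonMangoldt_eq_zero_iff.2 hpp
    simp [hΛ]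

/-- **Composite nodes are not load-bearing modulo RH**: under `RiemannHypothesis` the crux holds with the node
hypothesis restricted to prime powers `n = p^k` (everything else verbatim). Hence no
`_false_without_compositeNodes` lemma can exist short of `¬RH`; unconditionally this is the 2001 rigidity
`K ⊆ {Λ}` (fake weights vanish off prime powers). [folklore] -/
theorem signConeOscillatory_primePowerNodes_of_riemannHypothesis (hRH : RiemannHypothesis) :
    ∀ a : ℝ, 0 < a → ∀ (k : ℕ) (g : Fin k → ℝ → ℂ), (∀ i, (ContDiff ℝ ((⊤ : ℕ∞) : WithTop ℕ∞) (g i) ∧ HasCompactSupport (g i)) ∧ tsupport (g i) ⊆ Set.Icc (-a) a) → let F : ℝ → ℂ := fun t => ∑ i, MeasureTheory.convolution (g i) (fun u => (starRingEnd ℂ) ((g i) (-u))) (ContinuousLinearMap.mul ℂ ℂ) MeasureTheory.MeasureSpace.volume t; (∀ n : ℕ, 2 ≤ n → IsPrimePow n → 0 ≤ (F (Real.log n)).re) → (∃ t : ℝ, Real.log 2 ≤ |t| ∧ (F t).re < 0) → let M : ℂ → ℂ := fun s => ∫ u : ℝ, F u * Complex.exp ((s - 1 / 2) * u); -(F 0).re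 ≤ (M 0 + M 1 + ((1 / (2 * Real.pi) : ℂ) * (∫ t : ℝ, M (1 / 2 + t * Complex.I) * ((Complex.digamma (1 / 4 + t / 2 * Complex.I)).re : ℂ)) - F 0 * (Real.log Real.pi : ℂ))).re := by
  intro a _ha k g hg F hn _hosc
  show -(F 0).re ≤ (weilPolarTerm F + weilArchTerm F).re
  have hF : F = fun t => ∑ i, weilConv (g i) (weilReflect (g i)) t := rfl
  have hgi : ∀ i, IsWeilTest (g i) := fun i => (hg i).1
  have hGi : ∀ i, IsWeilTest (weilConv (g i) (weilReflect (g i))) := fun i =>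
    (hgi i).weilConv (hgi i).weilReflect
  have hFt : IsWeilTest F := by
    rw [hF]
    exact stub_branchesContinuous_isWeilTest_sum _ fun i _ => hGi i
  have hdec : weilPolarTerm F + weilArchTerm F = weilFunctional F + weilPrimeTerm F := by
    unfold weilFunctional
    ring
  have hW : weilFunctional F = ∑ i, weilQuadratic (g i) := by
    rw [hF, stub_branchesContinuous_weilFunctional_sum _ fun i _ => hGi i]
    rfl
  have hWP : WeilPositivity := WeilPositivity.of_riemannHypothesis explicit_formula_holds hRH
  have hWre : 0 ≤ (weilFunctional F).re := by
    rw [hW, Complex.re_sum]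
    exact Finset.sum_nonneg fun i _ => hWP _ (hgi i)
  have hsym : ∀ t : ℝ, conj (F (-t)) = F t := by
    intro t
    simp only [hF, map_sum, conj_weilConv_weilReflect_neg]
  have hPre : 0 ≤ (weilPrimeTerm F).re := re_weilPrimeTerm_nonneg_of_primePowerNodes hFt.2 hsym hn
  have h0 : 0 ≤ (F 0).re := by
    rw [hF]
    simp only [Complex.re_sum, weilConv_weilReflect_apply_zero, Complex.ofReal_re]
    exact Finset.sum_nonneg fun i _ => integral_nonneg fun t => by positivity
  rw [hdec, Complex.add_re]
  linarith

/-- **The support hypothesis (and with it the cutoff `a`) carries no information by itself**: the crux implies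
its own version WITHOUT `tsupport (gᵢ) ⊆ [-a, a]` — apply the crux at a cutoff `a' = 1 + Σᵢ Rᵢ` containing every
support. (`a` occurs nowhere else in the item; the content is "all cutoffs", i.e. `a = ∞`.) [folklore] -/
theorem withoutSupport_of_crux (h : SignConeOscillatory) :
    ∀ a : ℝ, 0 < a → ∀ (k : ℕ) (g : Fin k → ℝ → ℂ), (∀ i, ContDiff ℝ ((⊤ : ℕ∞) : WithTop ℕ∞) (g i) ∧ HasCompactSupport (g i)) → let F : ℝ → ℂ := fun t => ∑ i, MeasureTheory.convolution (g i) (fun u => (starRingEnd ℂ) ((g i) (-u))) (ContinuousLinearMap.mul ℂ ℂ) MeasureTheory.MeasureSpace.volume t; (∀ n : ℕ, 2 ≤ n → 0 ≤ (F (Real.log n)).re) → (∃ t : ℝ, Real.log 2 ≤ |t| ∧ (F t).re < 0) → let M : ℂ → ℂ := fun s => ∫ u : ℝ, F u * Complex.exp ((s - 1 / 2) * u); -(F 0).re ≤ (M 0 + M 1 + ((1 / (2 * Real.pi) : ℂ) * (∫ t : ℝ, M (1 / 2 + t * Complex.I) * ((Complex.digamma (1 / 4 + t / 2 * Complex.I)).re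 : ℂ)) - F 0 * (Real.log Real.pi : ℂ))).re := by
  intro a _ha k g hg F hn hosc
  have hR : ∀ i, ∃ R : ℝ, 0 < R ∧ tsupport (g i) ⊆ Set.Icc (-R) R := by
    intro i
    obtain ⟨r, hr⟩ := (hg i).2.isCompact.isBounded.subset_closedBall 0
    refine ⟨|r| + 1, by positivity, fun y hy => ?_⟩
    have hy' := hr hy
    rw [Metric.mem_closedBall, dist_zero_right, Real.norm_eq_abs] at hy'
    rw [Set.mem_Icc]
    constructor <;> linarith [le_abs_self r, neg_abs_le y, le_abs_self y]
  choose R hRpos hRsub using hR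
  have hsum : ∀ i, R i ≤ ∑ j, R j := fun i =>
    Finset.single_le_sum (fun j _ => (hRpos j).le) (Finset.mem_univ i)
  have ha' : 0 < 1 + ∑ j, R j := by
    have : 0 ≤ ∑ j, R j := Finset.sum_nonneg fun j _ => (hRpos j).le
    linarith
  have hsub : ∀ i, tsupport (g i) ⊆ Set.Icc (-(1 + ∑ j, R j)) (1 + ∑ j, R j) := by
    intro i y hy
    have hy' := hRsub i hy
    rw [Set.mem_Icc] at hy' ⊢
    constructor <;> linarith [hsum i, hy'.1, hy'.2]
  exact h (1 + ∑ j, R j) ha' k g (fun i => ⟨hg i, hsub i⟩) hn hosc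

/-- The case `k = 0` is vacuous (`F = 0` is not oscillatory), whatever the cutoff. [folklore] -/
theorem not_oscillatory_of_k_eq_zero (g : Fin 0 → ℝ → ℂ) :
    ¬ ∃ t : ℝ, Real.log 2 ≤ |t| ∧
      ((fun t => ∑ i, MeasureTheory.convolution (g i) (fun u => (starRingEnd ℂ) ((g i) (-u)))
        (ContinuousLinearMap.mul ℂ ℂ) MeasureTheory.MeasureSpace.volume t) t).re < 0 := by
  rintro ⟨t, -, ht⟩
  simp at ht

/-! ## §A′ Near-miss (documented `sorry`): origin domination does not rescue §A

The crux with the cone structure replaced by "`F` smooth, compactly supported in `[-2a, 2a]`, hermitian AND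
origin-dominating (`‖F t‖ ≤ Re F(0)` for all `t`)" — node hypothesis, oscillation hypothesis, conclusion verbatim.
CLAIM: false. Sketch of witness (`a = 3/2`): `F = h₀ - Σ_{n ∈ {2,4,8,16}} (h_n(· - L_n) + h_n(· + L_n))`, `h₀` a
plateau bump (`ContDiffBump`, `rIn = 1/5`, `rOut = 1/4`, height `1`), `h_n` plateau bumps of height `1` filling
the node gaps `(log n, log(n+1))` (`j·log 2 ≤ log 2^j ≤ j·0.6932`, `log(n+1) ≥ log n + 1/(n+1)`), so `F(0) = 1`,
`‖F‖ ≤ 1`, `F(log m) = 0·… ≥ 0`, `Re F(L_2) = -1 < 0`. Bombieri bookkeeping (crude cells):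
`Re W_ar(h₀) + 1 ≤ 4·cosh(1/8)/4 - (log 4π + γ) + (1/20)/sinh(1/5) - log tanh(1/8) + 1 ≈ 0.97`, and each far pair
contributes `-(4cosh((L-r)/2) - e^{(L+r)/2}/sinh(L-r))·2 rIn ≈ -0.64, -0.58, -0.45, -0.35`; total `≈ -1.05 < 0`.
OBSTRUCTION to closing now: ≈ 800 lines of interval bookkeeping (decimal cells for `exp`, `sinh`, `cosh`, `log` at
a dozen points; the singular cell `∫₀^{rIn} (e^{t/2} - 1)/sinh t ≥ 0` is sign-trivial thanks to the plateau).
REFINED PLAN (checked by hand with LOSSY cells `sinh x ≥ x`, `cosh x ≥ 1 + x²/4`, `e^y ≤ 1/(1-y)`, `γ > 1/2`,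
`log π ≥ 1 + (1 - 3/π)`): central cost `C₀ = Re W_ar(b) + 1 ≤ 4 rOut cosh(rOut/2) - (log 4π + γ) + log(1/rIn)
+ 2e^{-1}/(1-e^{-2}) + 1 ≈ 1.36` at `rIn = 1/4` (minorant `0 · 𝟙_{(0,rIn]} - 𝟙_{(rIn,1]}/t - 2e^{-t}/(1-e^{-2})`
for Bombieri's integrand, integrability from `integrableOn_bombieriMajorant`); negative plateau pairs of height
`1`: a NEAR pair in `(0.30, 0.68) ⊂ (rOut, log 2)` (no node arithmetic at all, net `≈ -0.5`) plus gap pairs above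
`n = 2, 3, 4, 8, 16` (endpoints via `j log 2 ∈ [0.6931 j, 0.6932 j]`, `log(n+1) ≥ log n + 1/(n+1)`,
`log 3 ≤ log 4 - 1/4`), nets `≈ -0.25, -0.30, -0.31, -0.26, -0.18` with the lossy cells (about twice that with
`sinh x ≥ x + x³/6`, `cosh x ≥ 1 + x²/2`): total `≈ -0.4` (lossy) to `≈ -1.5` (tight) — feasible, deferred to a
later cycle. WHAT WAS TRIED: the `F(0) = 0` witness of §A (lands); plateau design to kill the `1/sinh`
singularity; gap arithmetic via powers of `2` only. Value if closed: separates this crux from `SignConeFarField`,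
whose landed bookkeeping proof uses exactly hermitian + origin domination + far-field sign. -/

/-- §A′ (near-miss, see the section docstring): origin domination + hermitian + node signs + oscillation do not
imply the unit-slack inequality. NOT YET PROVED — documented `sorry` (crux workfile only). [folklore] -/
theorem signConeOscillatory_false_without_PD_originDominating :
    ¬ (∀ a : ℝ, 0 < a → ∀ F : ℝ → ℂ,
        (ContDiff ℝ ((⊤ : ℕ∞) : WithTop ℕ∞) F ∧ HasCompactSupport F) ∧ tsupport F ⊆ Set.Icc (-(2 * a)) (2 * a) →
        (∀ u : ℝ, F (-u) = (starRingEnd ℂ) (F u)) → (∀ u : ℝ, ‖F u‖ ≤ (F 0).re) →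
        (∀ n : ℕ, 2 ≤ n → 0 ≤ (F (Real.log n)).re) → (∃ t : ℝ, Real.log 2 ≤ |t| ∧ (F t).re < 0) →
        let M : ℂ → ℂ := fun s => ∫ u : ℝ, F u * Complex.exp ((s - 1 / 2) * u);
        -(F 0).re ≤ (M 0 + M 1 + ((1 / (2 * Real.pi) : ℂ) * (∫ t : ℝ, M (1 / 2 + t * Complex.I) *
          ((Complex.digamma (1 / 4 + t / 2 * Complex.I)).re : ℂ)) - F 0 * (Real.log Real.pi : ℂ))).re) := by
  sorry

/-! ## §N Numerics (kit job j020695, this seat): WHICH node constraints carry the unit slack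

LP probe in ideator-2's polyhedral sub-cone of `P(a)` (cosine-modulated p.d. windows; `W_ar` by Bombieri quadrature;
script `job_nodesets/run.py` attached with the job): `min Re W_ar(F)/F(0)` under `F(0) = 1` and node constraints
`F(log n) ≥ 0` for `n` in a SUBSET `S` of `{2, …, ⌊e^{2a}⌋}`. Crux threshold `-1`, exact `(S)` threshold `0`.

| `a` | `x = e^{2a}` | all | prime powers | primes only | all but 2 | all but 2,3 | all but 2,3,4,5 | all but n ≤ 7 | odd n only | composites only | none |
|-----|------|--------|--------|--------|--------|--------|--------|--------|--------|--------|--------|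
| 1.0 | 7.4  | +0.048 | +0.047 | -0.147 | -0.390 | -0.638 | -0.962 | -0.964 | -0.394 | -0.962 | -0.964 |
| 1.5 | 20.1 | +0.033 | +0.033 | -0.377 | -0.406 | -0.654 | -0.987 | -1.175 | -0.411 | -0.989 | -1.949 |
| 2.0 | 54.6 | +0.025 | +0.025 | -0.451 | -0.424 | -0.677 | -1.014 | -1.267 | -0.431 | -1.014 | -3.885 |
| 2.3 | 99.5 | +0.021 | +0.021 | -0.460 | -0.433 | -0.684 | -1.005 | -1.270 | -0.440 | -1.005 | -5.623 |

Reading (sub-cone values are UPPER bounds for the true cone minima; all consistent with RH, zero side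
`W = W_ar - P_Λ ∈ [0.02, 0.12]` at every optimiser): (i) prime-power nodes give EXACTLY the all-nodes value —
composite nodes are numerically irrelevant, matching `signConeOscillatory_primePowerNodes_of_riemannHypothesis`;
(ii) the unit slack ABSORBS the loss of node `2` alone (`-0.43 > -1`; a priori at most `2Λ(2)/√2 = 0.980`), of
`{2, 3}` (`-0.68`), of all even nodes (`-0.44`) and even of ALL proper prime powers (`primes only`: `-0.46`,
saturating by `x = 100`); (iii) it does NOT absorb the loss of `{2,3,4,5}` (`-1.005 … -1.014 < -1` from `x ≈ 55`)
nor of `n ≤ 7` (`-1.27`): quantitatively the load-bearing node signs are those at the first few primes. For a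
prover: the hypothesis is used through `P_Λ(F) ≥ 0`, and the slack `F(0)` is worth about one small prime.

-/

/-! ## §T Targets — line `Sketch` (`Cruxes/SignConeOscillatory/Lines/Sketch.lean`, lead 22:41Z)

No `stub_*_false` is possible: all seven stubs were re-derived on paper by this seat (signs and constants
included) and are TRUE as stated; the composition `SignConeOscillatory_of` is sorry-free in the skeleton, so
joint sufficiency is kernel-checked. Record of the checks (for the lead; `s = 1/2 + iy`, `F̂(y) = weilMellin F s`,
inversion `∫ F̂(y) e^{-iyu} dy = 2π F(u)`):
* `stub_polePairing` — TRUE: `N^{1-s}/(s-1) = -∫_{u > -log N} e^{(s-1)u} du` (`Re(s-1) = -1/2`), Fubini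
  (absolute: `e^{-u/2}` integrable on `u > -log N`, `F̂` of rapid decay), inversion gives
  `-2π ∫_{v < log N} e^{v/2} F(v) dv = -2π F̂(1)` because `supp F ⊆ (-∞, log N]`. Integrability: `|N^{1-s}| = √N`,
  `|1/(s-1)| ≤ 2`.
* `stub_remainderPairing` — TRUE: `bernoulliIntegral 1 N s = ∫_{x>N} B̃₁(x) x^{-(s+1)} dx` (tree def, line 197 of
  `EulerMaclaurinZeta.lean`); `s F̂(s) = (F/2 - F′)^(s)` (`weilMellin_deriv`), and for `x ≥ N`
  `∫ (F/2-F′)^(s) x^{-s-1} dy = 2π x^{-3/2} (F/2 - F′)(log x) = 0`; Fubini is absolute (`|B̃₁| ≤ 1/2`, `x^{-3/2}`).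
* `stub_zetaLineIntegrable` — TRUE (convexity bound `ζ(1/2+iy) ≪ |y|^{1/4+ε}` is more than enough against
  `F̂ = O((1+y²)^{-3})`, `norm_weilMellin_le_cube`).
* `stub_spectralArchPolar` — TRUE, pure bookkeeping: with `hP`, `∫|ĝ|²(ζ - ζ_N) = -2π k̂(1)` (the node sums over
  `Icc 1 N` cancel exactly — same range on both sides, checked), so `-(1/π) Re ∫|ĝ|²(ζ-ζ_N) = 2 Re k̂(1) = Re polar(k)`
  (`k̂(0) = conj k̂(1)` for `k = g ⋆ g̃`), `(1/2π)∫|ĝ|² = ‖g‖₂²` pays the `-1`, `-log π` is `weilArchTerm`'s constant.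
* `stub_combPairing` — TRUE: `∫ |ĝ|² 2cos(y log n) dy = 2π(k(log n) + k(-log n)) = 4π Re k(log n)`.
* `stub_certificateSuffices` — TRUE and elementary (`Σᵢ ∫|ĝᵢ|² dσ ≥ 0` holds even for junk integrals: a
  `Measure` is positive and the integrand is `≥ 0`; additivity `weilArchPolar_finset_sum`; `P_c(F) ≥ 0` on the
  sign cone needs `c ≥ 0` ONLY for `2 ≤ n ≤ N` — the stub asks `∀ n`, harmless). The node hypothesis of the crux
  enters the whole line exactly here, once (consistent with §B).
* `stub_fakeZeroMeasure` (terminal, held by the lead) — RH-IMPLIED with `c = Λ·𝟙_{n ≤ N}` and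
  `σ = (2π)⁻¹·volume + Σ_ρ m_ρ δ_{Im ρ}` (explicit formula; `N ≥ e^{2a}` makes the comb see every node of
  `k = g ⋆ g̃`, `supp k ⊆ [-2a, 2a]`), hence NOT killable short of `¬RH`; conversely it gives the crux
  (`SignConeOscillatory_of`), so by §0 it is RH-EQUIVALENT given the sibling cruxes. Its only soft spot is
  UNIFORMITY: one `(N, c, σ)` must serve every `g` on `[-a, a]` — true for the RH certificate, and exactly the
  Krein-dual form of the unit-slack inequality at cutoff `a` otherwise (card B); no cheaper attack surface found.
-/

end Summit.RiemannHypothesis.RiemannHypothesis.Cruxes.SignConeOscillatory.Disproof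

end
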